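import Mathlib
import Literature.NumberTheory.Transcendental.ZagierDilogarithmConjecture
import Literature.NumberTheory.Transcendental.BlochWignerDilogarithmVolumeProofs
import Summits.KontsevichZagierPeriods.KontsevichZagierPeriods.Theorems.HyperbolicBlochSectorReduction
import Summits.KontsevichZagierPeriods.KontsevichZagierPeriods.Theorems.HyperbolicBlochZagierDilogarithmConjectureStubExplainedToKZ
import Summits.KontsevichZagierPeriods.KontsevichZagierPeriods.Theorems.HyperbolicBlochZagierDilogarithmConjectureStubSexticSector
import HarnessLib

/-!
# `ZagierDilogarithmConjecture` (stmt-KontsevichZagierPeriods-10550) — line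
`kummer-clausen-linearisation` (reshape c4, "the cyclotomic sector, exactly"), stub
`stub_sexticKZ`

**The sextic sector of Conjecture 1 on ideal tetrahedra holds UNCONDITIONALLY.** Let `T(z)` be the
ideal tetrahedron of `ℍ³` with vertices `0, 1, z, ∞` (upper half-space model) and
`ρ z = [T(z), t⁻³]` the standard Kontsevich–Zagier integral representations of its hyperbolic
volume (domain `T z`, integrand `t⁻³` on `T z`, for algebraic `z` in the upper half plane). If
`u₁, …, u_k` are sixth roots of unity in the upper half plane and `n₁, …, n_k ∈ ℤ` satisfy
`Σ nᵢ value(ρ uᵢ) = 0`, then `Σ nᵢ [ρ uᵢ] ∈ KZ.relations`: the relation among the periods is a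
consequence of the three Kontsevich–Zagier rules. This is the conclusion of the route's
`TetraSector`, outright (no conjecture assumed), on the sector `μ₆ ∩ ℍ⁺ = {ζ₆, ζ₃}`.

Proof (what / why).
* Sixth roots of unity are algebraic (roots of `X⁶ − 1`), so the hypothesis on `ρ` applies at
  every `uᵢ`.
* VALUES ARE VOLUMES ARE DILOGARITHMS: `value(ρ u) = ∫_{T u} t⁻³`
  (`SectorReduction.value_eq_setIntegral_of_eqOn`: the value of a representation is the integral
  of its integrand over its domain), `T u = idealTetrahedron u` (the hypothesis on `T`, verbatim
  the definition), and `∫_{T(u)} t⁻³ = D(u)` for `Im u > 0`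
  (`BlochWignerVolume.idealTetrahedronVolume_eq_blochWignerDilog`, Milnor's computation of the
  volume of an ideal tetrahedron). Hence `Σ nᵢ D(uᵢ) = 0`.
* `stub_sexticSector` (tree): `Σ nᵢ [uᵢ] ∈ ⟨dilogRelators⟩`.
* `ZagierDilogarithmCertificate.stub_explainedToKZ` (tree): explained formal combinations of
  shapes in `ℍ⁺` are KZ relations for the standard representations.
Sorry-free; axioms ⊆ {propext, Classical.choice, Quot.sound}.

## References

* M. Kontsevich, D. Zagier, *Periods*, in: Mathematics Unlimited — 2001 and Beyond, Springer
  (2001), §1.2 (Conjecture 1; the example of hyperbolic volumes). [KontsevichZagier2001]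
* J. Milnor, *Hyperbolic geometry: the first 150 years*, Bull. AMS 6 (1982), Appendix (volume of
  an ideal tetrahedron). [Milnor1982]
-/

noncomputable section

open scoped BigOperators ComplexConjugate
open Literature.NumberTheory.Transcendental

namespace Summit.KontsevichZagierPeriods.HyperbolicBloch.ZagierDilogarithmCyclotomic

namespace SexticKZ

/-- A sixth root of unity is algebraic over `ℚ` (a root of `X⁶ − 1`). [folklore] -/
theorem isAlgebraic_of_pow_six_eq_one {u : ℂ} (hu : u ^ 6 = 1) : IsAlgebraic ℚ u := by
  refine ⟨Polynomial.X ^ 6 - 1, Polynomial.X_pow_sub_C_ne_zero (by norm_num) 1, ?_⟩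
  simp [hu]

/-- **Values of the standard representations are dilogarithms.** If `T` is pointwise the ideal
tetrahedron region and `ρ z` has domain `T z` and integrand `t⁻³` on `T z` (for algebraic `z` in
the upper half plane), then `value(ρ z) = D(z)` at every algebraic `z` with `Im z > 0`: the value is
`∫_{T(z)} t⁻³ = vol T(z)`, which is the Bloch–Wigner dilogarithm. [cite: Milnor1982, Appendix] -/
theorem value_eq_blochWignerDilog (T : ℂ → Set (Fin 3 → ℝ))
    (hT : ∀ z, T z = {p | 0 < p 1 ∧ z.re * p 1 < z.im * p 0 ∧
      z.im * (p 0 - 1) < (z.re - 1) * p 1 ∧ 0 < p 2 ∧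
      0 < z.im * (p 0 ^ 2 + p 1 ^ 2 + p 2 ^ 2 - p 0) + (z.re - Complex.normSq z) * p 1})
    (ρ : ℂ → KZ.IntegralRep 3) (hρ : ∀ z, IsAlgebraic ℚ z → 0 < z.im →
      (ρ z).domain = T z ∧ Set.EqOn (ρ z).integrand (fun p => 1 / p 2 ^ 3) (T z))
    {z : ℂ} (halg : IsAlgebraic ℚ z) (hz : 0 < z.im) :
    (ρ z).value = blochWignerDilog z := by
  rw [SectorReduction.value_eq_setIntegral_of_eqOn (hρ z halg hz).1 (hρ z halg hz).2]
  have hT' : T z = idealTetrahedron z := hT z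
  rw [hT', ← BlochWignerVolume.idealTetrahedronVolume_eq_blochWignerDilog hz]
  rfl

end SexticKZ

open SexticKZ

/-- **The sextic sector of Conjecture 1 on ideal tetrahedra, UNCONDITIONALLY** (stub
`stub_sexticKZ` of line `kummer-clausen-linearisation`): for the standard tetrahedral
representations `ρ`, every `ℤ`-relation among the periods `value(ρ u) = vol T(u) = D(u)`,
`u ∈ μ₆ ∩ ℍ⁺ = {ζ₆, ζ₃}`, is a KZ relation. Chain: `value(ρ u) = D(u)` (the volume theorem),
`stub_sexticSector` (Zagier's conjecture on the sixth roots of unity, proved), and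
`stub_explainedToKZ` (explained combinations are KZ relations). TetraSector's conclusion holds
outright on this sector. [cite: KontsevichZagier2001, §1.2] -/
theorem stub_sexticKZ :
    ∀ (T : ℂ → Set (Fin 3 → ℝ)), (∀ z, T z = {p | 0 < p 1 ∧ z.re * p 1 < z.im * p 0 ∧
      z.im * (p 0 - 1) < (z.re - 1) * p 1 ∧ 0 < p 2 ∧
      0 < z.im * (p 0 ^ 2 + p 1 ^ 2 + p 2 ^ 2 - p 0) + (z.re - Complex.normSq z) * p 1}) →
    ∀ (ρ : ℂ → KZ.IntegralRep 3), (∀ z, IsAlgebraic ℚ z → 0 < z.im →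
      (ρ z).domain = T z ∧ Set.EqOn (ρ z).integrand (fun p => 1 / p 2 ^ 3) (T z)) →
    ∀ (k : ℕ) (u : Fin k → ℂ) (n : Fin k → ℤ), (∀ i, u i ^ 6 = 1) → (∀ i, 0 < (u i).im) →
      ∑ i, (n i : ℝ) * (ρ (u i)).value = 0 →
        (∑ i, n i • KZ.of (ρ (u i))) ∈ KZ.relations := by
  intro T hT ρ hρ k u n hu him hsum
  -- (1) values are volumes are dilogarithms: `value(ρ uᵢ) = D(uᵢ)`
  have hval : ∀ i, (ρ (u i)).value = blochWignerDilog (u i) := fun i =>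
    value_eq_blochWignerDilog T hT ρ hρ (isAlgebraic_of_pow_six_eq_one (hu i)) (him i)
  have hsum' : ∑ i, (n i : ℝ) * blochWignerDilog (u i) = 0 := by
    simpa only [hval] using hsum
  -- (2) Zagier's conjecture on the sextic sector, then (3) transfer to the KZ calculus
  exact ZagierDilogarithmCertificate.stub_explainedToKZ T hT ρ hρ k u n him
    (stub_sexticSector k u n hu him hsum')

end Summit.KontsevichZagierPeriods.HyperbolicBloch.ZagierDilogarithmCyclotomic

end
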